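import Summits.Parity.GeneralizedHardyLittlewood.Theorems.FordMaynardNoSieveConst0164NegWitness0164LogKernel

/-!
# Route `FordMaynardNoSieveConst0164`, crux `NegWitness0164` (stmt-Parity-19102), line `birth`,
# stub `stub_tweakNeg0164`: `J₃` as a one-dimensional integral of the two-dimensional kernel

Helper file toward the certificate stub (K. Ford, J. Maynard, *On the theory of prime producing sieves*,
arXiv:2407.14368, §8: "`I₃ = -2∫ dx/(x₁x₂x₃) = -2∫_ν^{1/3} log((1-x)/max(x,1/2-x) - 1)/(x(1-x)) dx`").  Inequality (I) of
`stub_tweakNeg0164_of_table` (`…Witness`) involves `J₃ = ∫_{v ∈ Δ₃(1)} 𝟙[ν ≤ vᵢ < 1/2]/(v₀v₁v₂)` (`ν = 41/250`,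
`J₃ = 2.5705…`).  Peeling the last coordinate (`sliceIntegral_succ_succ_snoc`):

* `J3_eq_integral_kernel_0164` — `J₃ = ∫_{t ∈ (0,1]} 𝟙[ν ≤ t < 1/2] · (1/t) · K(1 - t) dt` with the two-dimensional kernel
  `K(w) = ∫_{Δ₂(w)} 𝟙[ν ≤ vᵢ < 1/2]/(v₀v₁)` of `…F3Lower`/`…LogKernel` (`K(w) = (2/w) log((1/2)/(w − 1/2))` for
  `w ≥ 1/2 + ν`, `K3_eq_log_upper_0164`).

Def-free.  References: [FordMaynard2024PrimeSieves] arXiv:2407.14368, §8 (I₃), §4.2.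
-/

noncomputable section

open Finset MeasureTheory Set
open scoped Classical
open Literature.NumberTheory.Sieve Literature.NumberTheory.Sieve.FordMaynard

namespace Summit.Parity.GeneralizedHardyLittlewood.FordMaynardNoSieveConst0164NegWitness0164

/-- For `v : Fin 2 → ℝ`: `snoc v t = (v 0, v 1, t)`. [folklore] -/
theorem snoc_fin_two_eq (v : Fin 2 → ℝ) (t : ℝ) : (Fin.snoc v t : Fin 3 → ℝ) = ![v 0, v 1, t] := by
  ext i
  fin_cases i
  · rfl
  · rfl
  · rfl

/-- The integrand of `J₃` is measurable. [folklore] -/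
theorem measurable_J3_integrand_0164 : Measurable (fun v : Fin 3 → ℝ =>
    if (∀ i, (41 / 250 : ℝ) ≤ v i) ∧ (∀ i, v i < 1 / 2) then 1 / (v 0 * v 1 * v 2) else 0) := by
  refine Measurable.ite ?_ (measurable_const.div (((measurable_pi_apply 0).mul (measurable_pi_apply 1)).mul
    (measurable_pi_apply 2))) measurable_const
  have h : {v : Fin 3 → ℝ | (∀ i, (41 / 250 : ℝ) ≤ v i) ∧ ∀ i, v i < 1 / 2} =
      (⋂ i, {v | (41 / 250 : ℝ) ≤ v i}) ∩ ⋂ i, {v : Fin 3 → ℝ | v i < 1 / 2} := by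
    ext v; simp
  rw [h]
  exact (MeasurableSet.iInter fun i => measurableSet_le measurable_const (measurable_pi_apply i)).inter
    (MeasurableSet.iInter fun i => measurableSet_lt (measurable_pi_apply i) measurable_const)

/-- **`J₃` as a one-dimensional integral of the two-dimensional kernel**:
`∫_{Δ₃(1)} 𝟙[ν ≤ vᵢ < 1/2]/(v₀v₁v₂) = ∫_{t ∈ (0,1]} 𝟙[ν ≤ t < 1/2] (1/t) ∫_{Δ₂(1-t)} 𝟙[ν ≤ vᵢ < 1/2]/(v₀v₁) dt`.
[cite: FordMaynard2024PrimeSieves, §8 (I₃ as an iterated integral)] -/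
theorem J3_eq_integral_kernel_0164 :
    sliceIntegral 3 1 (fun v : Fin 3 → ℝ =>
      if (∀ i, (41 / 250 : ℝ) ≤ v i) ∧ (∀ i, v i < 1 / 2) then 1 / (v 0 * v 1 * v 2) else 0) =
      ∫ t in Ioc (0 : ℝ) 1, (if (41 / 250 : ℝ) ≤ t ∧ t < 1 / 2 then
        1 / t * sliceIntegral 2 (1 - t) (fun v : Fin 2 → ℝ =>
          if (∀ i, (41 / 250 : ℝ) ≤ v i) ∧ (∀ i, v i < 1 / 2) then 1 / (v 0 * v 1) else 0) else 0) := by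
  rw [sliceIntegral_succ_succ_snoc 1 1 measurable_J3_integrand_0164 (C := (250 / 41) ^ 3) (by positivity)
    (fun v hv _ => by
      split_ifs with h
      · have h0 := h.1 0; have h1 := h.1 1; have h2 := h.1 2
        rw [abs_of_pos (by have := hv 0; have := hv 1; have := hv 2; positivity), div_le_iff₀ (by
          have := hv 0; have := hv 1; have := hv 2; positivity)]
        have h01 : (41 / 250 : ℝ) * (41 / 250) ≤ v 0 * v 1 := mul_le_mul h0 h1 (by norm_num) (by linarith)
        nlinarith [mul_le_mul h01 h2 (by norm_num) (by have := hv 0; have := hv 1; positivity)]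
      · norm_num)]
  refine setIntegral_congr_fun measurableSet_Ioc fun t ht => ?_
  have hcond3 : ∀ v : Fin 2 → ℝ, ((∀ i, (41 / 250 : ℝ) ≤ (Fin.snoc v t : Fin 3 → ℝ) i) ∧
      (∀ i, (Fin.snoc v t : Fin 3 → ℝ) i < 1 / 2)) ↔
      (((41 / 250 : ℝ) ≤ v 0 ∧ (41 / 250 : ℝ) ≤ v 1 ∧ (41 / 250 : ℝ) ≤ t) ∧ (v 0 < 1 / 2 ∧ v 1 < 1 / 2 ∧ t < 1 / 2)) := by
    intro v
    rw [snoc_fin_two_eq]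
    constructor
    · rintro ⟨h, h'⟩
      exact ⟨⟨by simpa using h 0, by simpa using h 1, by simpa using h 2⟩,
        ⟨by simpa using h' 0, by simpa using h' 1, by simpa using h' 2⟩⟩
    · rintro ⟨⟨h0, h1, h2⟩, ⟨h0', h1', h2'⟩⟩
      refine ⟨fun i => ?_, fun i => ?_⟩
      · fin_cases i
        · simpa using h0
        · simpa using h1
        · simpa using h2
      · fin_cases i
        · simpa using h0'
        · simpa using h1'
        · simpa using h2'
  have hprod3 : ∀ v : Fin 2 → ℝ, (Fin.snoc v t : Fin 3 → ℝ) 0 * (Fin.snoc v t : Fin 3 → ℝ) 1 *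
      (Fin.snoc v t : Fin 3 → ℝ) 2 = v 0 * v 1 * t := by
    intro v; rw [snoc_fin_two_eq]; rfl
  have hcond2 : ∀ v : Fin 2 → ℝ, ((∀ i, (41 / 250 : ℝ) ≤ v i) ∧ (∀ i, v i < 1 / 2)) ↔
      (((41 / 250 : ℝ) ≤ v 0 ∧ (41 / 250 : ℝ) ≤ v 1) ∧ (v 0 < 1 / 2 ∧ v 1 < 1 / 2)) := by
    intro v
    simp only [Fin.forall_fin_two]
  show sliceIntegral 2 (1 - t) (fun v : Fin 2 → ℝ => (fun v : Fin 3 → ℝ =>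
      if (∀ i, (41 / 250 : ℝ) ≤ v i) ∧ (∀ i, v i < 1 / 2) then 1 / (v 0 * v 1 * v 2) else 0) (Fin.snoc v t)) = _
  simp only [hcond3, hprod3, hcond2]
  by_cases hc : (41 / 250 : ℝ) ≤ t ∧ t < 1 / 2
  · rw [if_pos hc, ← sliceIntegral_const_mul]
    refine sliceIntegral_congr fun v hv hvs => ?_
    have ht0 : 0 < t := ht.1
    by_cases h2 : ((41 / 250 : ℝ) ≤ v 0 ∧ (41 / 250 : ℝ) ≤ v 1) ∧ (v 0 < 1 / 2 ∧ v 1 < 1 / 2)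
    · rw [if_pos ⟨⟨h2.1.1, h2.1.2, hc.1⟩, ⟨h2.2.1, h2.2.2, hc.2⟩⟩, if_pos h2]
      have := hv 0; have := hv 1
      field_simp
    · rw [if_neg h2, mul_zero, if_neg]
      rintro ⟨⟨h0, h1, -⟩, ⟨h0', h1', -⟩⟩
      exact h2 ⟨⟨h0, h1⟩, ⟨h0', h1'⟩⟩
  · rw [if_neg hc]
    refine (sliceIntegral_congr (G' := fun _ => 0) fun v hv hvs => ?_).trans (sliceIntegral_zero _ _)
    rw [if_neg]
    rintro ⟨⟨-, -, h⟩, ⟨-, -, h'⟩⟩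
    exact hc ⟨h, h'⟩

end Summit.Parity.GeneralizedHardyLittlewood.FordMaynardNoSieveConst0164NegWitness0164

end
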